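import Mathlib
import Literature.Analysis.FluidPDE.VorticityCalculus
import Summits.NavierStokesRegularity.NavierStokesRegularity.Theorems.ThreadingFluxHorizonTowerSphereRigidity
import Summits.NavierStokesRegularity.NavierStokesRegularity.Theorems.ThreadingFluxHorizonTowerPoloidalFieldCalculus
import Summits.NavierStokesRegularity.NavierStokesRegularity.Theorems.ThreadingFluxHorizonTowerProfileFormulas
import Summits.NavierStokesRegularity.NavierStokesRegularity.Theorems.ThreadingFluxHorizonTowerFirstLemmas
import Summits.NavierStokesRegularity.NavierStokesRegularity.Theorems.ThreadingFluxPrecessionConicalEulerTools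
import HarnessLib

/-!
# Crux `PoloidalLiouville` (stmt-NavierStokesRegularity-1222, W1), crux idea «precession-gap» (ns-idea-15):
# CONICAL STEADY EULER RIGIDITY — item (J) `ConicalSteadyEulerRigidity` of `Cruxes/PoloidalLiouville/PrecessionSketch.lean`
# (l.235, «steady-horizon remark», S/M), PROVED (body VERBATIM)

Support file (`--supports stmt-NavierStokesRegularity-1222`, helper).  Experiment cell `ns-wall-extremal`, width hand
ns-wall-eng-4 g4.  0 kit.  The sketch has no Theorems-side twin for this statement, so the theorem below carries the sketch
BODY VERBATIM (`divergence = Literature.Analysis.FluidPDE.VectorCalculus.divergence`, `curl = Literature.Analysis.FluidPDE.curl`).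

## Statements (`Precession.conicalSteadyEulerRigidity` = sketch (J) VERBATIM; `…_of_contDiffOn` = its `C²` strengthening)

Let `U : ℝ³ → ℝ³` and `P : ℝ³ → ℝ` be real-analytic off the origin (for `…_of_contDiffOn`: merely `C²` off the origin), `U` degree-0 homogeneous (`U (c x) = U x`, `c > 0`),
`P` degree-0 homogeneous off `0`, `div U = 0` off `0`, STEADY EULER `DU(x)[U x] + ∇P(x) = 0` off `0`, and the vorticity tangent
to the spheres about the origin (`⟪x, curl U x⟫ = 0` off `0`).  Then `U` is CONSTANT off the origin.  (The blow-down horizon of a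
steady unthreaded flow is rigid already at order one, provided the pressure carries no `log r` term — the card's remark.)

## Proof (Hodge-free, no spherical harmonics; in fact only `C²`-regularity of `U`, `P` off `0` is used)

Write `r = ‖x‖`, `ξ = x/r`, radial part `f = ⟪U, ξ⟫` (degree 0), tangential part `W = U − f ξ` (degree 0, `⟪W, x⟫ = 0`), and the
TEST FIELD `H = W/r − ∇f` (tangential, degree −1).
1. `div U = 0`, `⟪curl U, x⟫ = 0` pass to `W` (`curl (φ x) = ∇φ × x` is tangent to spheres), so eng-4 g3's
   `HorizonTower.SphereRigidity.curl_eq_smul_cross` gives `curl W = (x × W)/r²`; with `∇(f/r) × x = (∇f × x)/r` this is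
   `curl U = (x × H)/r`, and `curl H = ∇(1/r) × W + (x × W)/r³ − curl ∇f = 0`.
2. RADIAL EULER BALANCE.  `⟪U × x, curl U⟫ = ⟪x, DU[U]⟫ − ⟪U, DU[x]⟫` (Literature `inner_cross_curl`) `= −⟪x, ∇P⟫ − 0 = 0`
   (Euler identities `DU(x)[x] = 0`, `⟪∇P(x), x⟫ = 0` for degree-0 data); Binet–Cauchy turns `⟪U × x, x × H⟫ = 0` into
   `⟪U, H⟫ = 0`, i.e. `⟪W, H⟫ = 0`.
3. TANGENTIAL EULER BALANCE.  For the head `B = P + |U|²/2`: `⟪∇B, e⟫ = ⟪∇P, e⟫ + ⟪U, DU[e]⟫ = −⟪U × e, curl U⟫ = −f ⟪H, e⟫`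
   (Lamb's identity through `inner_cross_curl`, then step 2), so `∇B = −f H` off `0`; hence `0 = −curl ∇B = curl (f H) =
   ∇f × H + f curl H = ∇f × H`.
4. POINTWISE DICHOTOMY.  Where `H ≠ 0`: `∇f = μ H` (step 3), `W = r(H + ∇f) = r(1 + μ)H` and `⟪W, H⟫ = 0` force `μ = −1`,
   i.e. `W = 0`.  So on the OPEN set `{H ≠ 0}` the tangential part vanishes identically; there `div W = −2f/r` gives `f = 0`,
   hence `∇f = 0` and `H = W/r − ∇f = 0` — a contradiction.  Thus `H ≡ 0`, i.e. `curl U ≡ 0` off the origin.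
5. An irrotational, divergence-free field `C²` off `0` is harmonic there (`curl curl = ∇ div − Δ`, Literature
   `curl_curl_eq_sum_fderiv_divergence_sub_laplacian`, localised with a `ContDiffBump` cut-off); each coordinate `Uᵢ` is then
   harmonic on the connected open set `ℝ³ ∖ {0}` and degree-0 homogeneous, so it attains its maximum over the unit sphere at an
   interior point and is constant (Literature `divForm_strongMaximumPrinciple_of_contDiff`, exactly as in
   `ThreadingFluxHorizonTowerSphereRigidity` step 4).

HONEST FRAME: an information-grade rigidity statement about hypothetical scale-free steady horizons of unthreaded flows; the
card's rungs (`ShortPeriodCollapse`, `FastPrecession…`, `SteadyPoloidalLiouville…`) are not touched; `PoloidalLiouville` (1222)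
and NS regularity stay OPEN; W1/W2 movement 0.

## References
* planner ns-idea-15, `Cruxes/PoloidalLiouville/Ideas/precession-gap.md` §steady, `…/PrecessionSketch.lean` l.235 (J).
* A. J. Majda, A. L. Bertozzi, *Vorticity and Incompressible Flow* (CUP 2002), §1.1 (vector identities), §2.4.1. [MajdaBertozziCUP2002]
* D. Gilbarg, N. S. Trudinger, *Elliptic PDE of Second Order*, Thm 3.5 (strong maximum principle). [GilbargTrudinger2001]
-/

-- the summit and its single problem share the name (D-0017 nested layout)
set_option linter.dupNamespace false

noncomputable section

namespace Summit.NavierStokesRegularity.NavierStokesRegularity.Theorems.PoloidalLiouville.Precession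

open Set Function Filter Topology Metric
open scoped Topology RealInnerProductSpace Laplacian ContDiff
open Literature.Analysis.FluidPDE
open Summit.NavierStokesRegularity.NavierStokesRegularity.Theorems.PoloidalLiouville.HorizonTower (E3)

open ConicalEuler in
/-- **CONICAL STEADY EULER RIGIDITY, `C²` FORM** (the sketch's (J) with real-analyticity weakened to `C²` off the origin — the
proof never uses analytic continuation): a degree-0 homogeneous steady Euler field `U ∈ C²(ℝ³ ∖ {0})` with degree-0 homogeneous
pressure `P ∈ C²(ℝ³ ∖ {0})`, divergence free, with vorticity tangent to the spheres about `0`, is CONSTANT off the origin.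
[cite: MajdaBertozziCUP2002, §1.1 (vector identities), §2.4.1; GilbargTrudinger2001, Thm 3.5] -/
theorem conicalSteadyEulerRigidity_of_contDiffOn (U : E3 → E3) (P : E3 → ℝ)
    (hU : ContDiffOn ℝ 2 U {0}ᶜ) (hP : ContDiffOn ℝ 2 P {0}ᶜ)
    (hUhom : ∀ c : ℝ, 0 < c → ∀ x, U (c • x) = U x) (hPhom : ∀ c : ℝ, 0 < c → ∀ x, x ≠ 0 → P (c • x) = P x)
    (hdiv : ∀ x, x ≠ 0 → VectorCalculus.divergence U x = 0)
    (hEuler : ∀ x, x ≠ 0 → fderiv ℝ U x (U x) + gradient P x = 0)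
    (hrot : ∀ x, x ≠ 0 → inner ℝ x (curl U x) = 0) :
    ∃ a : E3, ∀ x, x ≠ 0 → U x = a := by
  have hopen : IsOpen ({0}ᶜ : Set E3) := isOpen_compl_singleton
  /- regularity off the origin -/
  have hnormC : ContDiffOn ℝ 2 (fun w : E3 => ‖w‖) {0}ᶜ := fun z hz =>
    (contDiffAt_norm ℝ (show z ≠ 0 from hz)).contDiffWithinAt
  have hninvC : ContDiffOn ℝ 2 (fun w : E3 => ‖w‖⁻¹) {0}ᶜ := hnormC.inv fun z hz => norm_ne_zero_iff.mpr hz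
  /- the radial part `f = ⟪U, ξ⟫`, the tangential part `W = U − f ξ`, the test field `H = W/r − ∇f`,
     the Bernoulli head `B = P + |U|²/2` -/
  set f : E3 → ℝ := fun w => inner ℝ (U w) w / ‖w‖ with hfdef
  set W : E3 → E3 := fun w => U w - (f w * ‖w‖⁻¹) • w with hWdef
  set H : E3 → E3 := fun w => ‖w‖⁻¹ • W w - gradient f w with hHdef
  set B : E3 → ℝ := fun w => P w + (1 / 2 : ℝ) * ‖U w‖ ^ 2 with hBdef
  have hfC : ContDiffOn ℝ 2 f {0}ᶜ :=
    (hU.inner ℝ contDiffOn_id).div hnormC fun z hz => norm_ne_zero_iff.mpr hz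
  have hgC : ContDiffOn ℝ 2 (fun w : E3 => f w * ‖w‖⁻¹) {0}ᶜ := hfC.mul hninvC
  have hWC : ContDiffOn ℝ 2 W {0}ᶜ := hU.sub (hgC.smul contDiffOn_id)
  have hgradfC : ContDiffOn ℝ 1 (gradient f) {0}ᶜ :=
    (InnerProductSpace.toDual ℝ E3).symm.contDiff.comp_contDiffOn (hfC.fderiv_of_isOpen hopen (by norm_cast))
  have hHC : ContDiffOn ℝ 1 H {0}ᶜ := ((hninvC.of_le (by norm_cast)).smul (hWC.of_le (by norm_cast))).sub hgradfC
  -- pointwise regularity off the origin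
  have hUd : ∀ z : E3, z ≠ 0 → DifferentiableAt ℝ U z := fun z hz =>
    ((hU z hz).contDiffAt (hopen.mem_nhds hz)).differentiableAt (by simp)
  have hU2 : ∀ z : E3, z ≠ 0 → ContDiffAt ℝ 2 U z := fun z hz =>
    (hU z hz).contDiffAt (hopen.mem_nhds hz)
  have hPd : ∀ z : E3, z ≠ 0 → DifferentiableAt ℝ P z := fun z hz =>
    ((hP z hz).contDiffAt (hopen.mem_nhds hz)).differentiableAt (by simp)
  have hP2 : ∀ z : E3, z ≠ 0 → ContDiffAt ℝ 2 P z := fun z hz =>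
    (hP z hz).contDiffAt (hopen.mem_nhds hz)
  have hfd : ∀ z : E3, z ≠ 0 → DifferentiableAt ℝ f z := fun z hz =>
    ((hfC z hz).contDiffAt (hopen.mem_nhds hz)).differentiableAt (by simp)
  have hf2 : ∀ z : E3, z ≠ 0 → ContDiffAt ℝ 2 f z := fun z hz =>
    (hfC z hz).contDiffAt (hopen.mem_nhds hz)
  have hgd : ∀ z : E3, z ≠ 0 → DifferentiableAt ℝ (fun w : E3 => f w * ‖w‖⁻¹) z := fun z hz =>
    ((hgC z hz).contDiffAt (hopen.mem_nhds hz)).differentiableAt (by simp)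
  have hninvd : ∀ z : E3, z ≠ 0 → DifferentiableAt ℝ (fun w : E3 => ‖w‖⁻¹) z := fun z hz =>
    ((hninvC z hz).contDiffAt (hopen.mem_nhds hz)).differentiableAt (by simp)
  have hWd : ∀ z : E3, z ≠ 0 → DifferentiableAt ℝ W z := fun z hz =>
    ((hWC z hz).contDiffAt (hopen.mem_nhds hz)).differentiableAt (by simp)
  have hgradfd : ∀ z : E3, z ≠ 0 → DifferentiableAt ℝ (gradient f) z := fun z hz =>
    ((hgradfC z hz).contDiffAt (hopen.mem_nhds hz)).differentiableAt (by simp)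
  have hHd : ∀ z : E3, z ≠ 0 → DifferentiableAt ℝ H z := fun z hz =>
    ((hHC z hz).contDiffAt (hopen.mem_nhds hz)).differentiableAt (by simp)
  have hB2 : ∀ z : E3, z ≠ 0 → ContDiffAt ℝ 2 B z := fun z hz =>
    (hP2 z hz).add (contDiffAt_const.mul ((hU2 z hz).norm_sq ℝ))
  /- homogeneity -/
  have hfhom : ∀ c : ℝ, 0 < c → ∀ y : E3, f (c • y) = f y := by
    intro c hc y
    by_cases hy : y = 0
    · rw [hy, smul_zero]
    · simp only [hfdef, hUhom c hc y, inner_smul_right, norm_smul, Real.norm_of_nonneg hc.le]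
      field_simp
  have hWhom : ∀ c : ℝ, 0 < c → ∀ y : E3, W (c • y) = W y := by
    intro c hc y
    by_cases hy : y = 0
    · rw [hy, smul_zero]
    · have e1 : f y * (c * ‖y‖)⁻¹ * c = f y * ‖y‖⁻¹ := by field_simp
      show U (c • y) - (f (c • y) * ‖c • y‖⁻¹) • (c • y) = U y - (f y * ‖y‖⁻¹) • y
      rw [hUhom c hc y, hfhom c hc y, norm_smul, Real.norm_of_nonneg hc.le, smul_smul, e1]
  have hWtan : ∀ z : E3, inner ℝ (W z) z = 0 := by
    intro z
    by_cases hz : z = 0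
    · rw [hz, inner_zero_right]
    · have hUz : inner ℝ (U z) z = f z * ‖z‖ := by
        simp only [hfdef]; rw [div_mul_cancel₀ _ (norm_ne_zero_iff.mpr hz)]
      simp only [hWdef, inner_sub_left, real_inner_smul_left, hUz, real_inner_self_eq_norm_sq]
      field_simp
      ring
  /- Euler identities -/
  have hEulerU : ∀ z : E3, z ≠ 0 → fderiv ℝ U z z = 0 := fun z hz =>
    HorizonTower.SphereRigidity.fderiv_apply_self_eq_zero hUhom (hUd z hz)
  have hEulerf : ∀ z : E3, z ≠ 0 → inner ℝ (gradient f z) z = 0 := by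
    intro z hz
    have hev : ∀ᶠ c in 𝓝 (1 : ℝ), f (c • z) = (fun _ : ℝ => (1 : ℝ)) c • f z := by
      filter_upwards [Ioi_mem_nhds (zero_lt_one' ℝ)] with c hc
      rw [hfhom c hc z, one_smul]
    have h := PoloidalField.fderiv_apply_self_of_homogeneous (a := fun _ : ℝ => (1 : ℝ)) (a' := 0) (hfd z hz)
      (hasDerivAt_const (1 : ℝ) (1 : ℝ)) hev
    rw [Literature.Analysis.FluidPDE.inner_gradient_left, h, zero_smul]
  have hEulerg : ∀ z : E3, z ≠ 0 → fderiv ℝ (fun w : E3 => f w * ‖w‖⁻¹) z z = -(f z * ‖z‖⁻¹) := by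
    intro z hz
    have hev : ∀ᶠ c in 𝓝 (1 : ℝ), (fun w : E3 => f w * ‖w‖⁻¹) (c • z) = (fun c : ℝ => c⁻¹) c • (f z * ‖z‖⁻¹) := by
      filter_upwards [Ioi_mem_nhds (zero_lt_one' ℝ)] with c hc
      simp only [hfhom c hc z, norm_smul, Real.norm_of_nonneg hc.le, mul_inv, smul_eq_mul]
      ring
    have ha : HasDerivAt (fun c : ℝ => c⁻¹) (-1 : ℝ) 1 := by
      simpa using (hasDerivAt_inv (one_ne_zero' ℝ))
    have h := PoloidalField.fderiv_apply_self_of_homogeneous (a := fun c : ℝ => c⁻¹) (a' := -1) (hgd z hz) ha hev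
    rw [h, smul_eq_mul, neg_one_mul]
  have hEulerP : ∀ z : E3, z ≠ 0 → inner ℝ (gradient P z) z = 0 := by
    intro z hz
    have hev : ∀ᶠ c in 𝓝 (1 : ℝ), P (c • z) = (fun _ : ℝ => (1 : ℝ)) c • P z := by
      filter_upwards [Ioi_mem_nhds (zero_lt_one' ℝ)] with c hc
      rw [hPhom c hc z hz, one_smul]
    have h := PoloidalField.fderiv_apply_self_of_homogeneous (a := fun _ : ℝ => (1 : ℝ)) (a' := 0) (hPd z hz)
      (hasDerivAt_const (1 : ℝ) (1 : ℝ)) hev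
    rw [Literature.Analysis.FluidPDE.inner_gradient_left, h, zero_smul]
  /- (1) the tangential part is radially irrotational, hence `curl W = (y × W)/r²` -/
  have hWrot : ∀ z : E3, z ≠ 0 → inner ℝ (curl W z) z = 0 := by
    intro z hz
    have hcurl : curl W z = curl U z - curl (fun w : E3 => (f w * ‖w‖⁻¹) • w) z :=
      curl_sub (hUd z hz) ((hgd z hz).smul differentiableAt_id)
    rw [hcurl, inner_sub_left, PoloidalField.curl_smul_self (hgd z hz), real_inner_comm, hrot z hz,
      Tao2016.inner_cross_self_right, sub_zero]
  have hcurlW : ∀ z : E3, z ≠ 0 → curl W z = ((‖z‖ ^ 2) ^ (-1 : ℝ)) • cross z (W z) := fun z hz =>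
    HorizonTower.SphereRigidity.curl_eq_smul_cross hWhom hWtan hz (hWd z hz) (hWrot z hz)
  /- (2) the vorticity in terms of the test field: `curl U = r⁻¹ (y × H)` -/
  have hω : ∀ z : E3, z ≠ 0 → curl U z = ‖z‖⁻¹ • cross z (H z) := by
    intro z hz
    have hnz : ‖z‖ ≠ 0 := norm_ne_zero_iff.mpr hz
    have hUeq : U = fun w => W w + (f w * ‖w‖⁻¹) • w := by
      funext w; simp only [hWdef, sub_add_cancel]
    have hgradg : gradient (fun w : E3 => f w * ‖w‖⁻¹) z
        = f z • ((-(‖z‖⁻¹ * (‖z‖ ^ 2)⁻¹)) • z) + ‖z‖⁻¹ • gradient f z := by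
      rw [HorizonTower.gradient_mul_apply (hfd z hz) (hninvd z hz), gradient_norm_inv hz]
    have hd1 : DifferentiableAt ℝ (fun w : E3 => (f w * ‖w‖⁻¹) • w) z := (hgd z hz).smul differentiableAt_id
    -- bilinearity bookkeeping for `cross`
    have hadd : ∀ a b c : E3, cross (a + b) c = cross a c + cross b c := fun a b c => by
      rw [cross_swap, Tao2016.cross_add_right, neg_add, ← cross_swap, ← cross_swap]
    have hsub : ∀ a b c : E3, cross a (b - c) = cross a b - cross a c := fun a b c => by
      simp [cross, map_sub]
    rw [hUeq, curl_add (hWd z hz) hd1, hcurlW z hz,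
      PoloidalField.curl_smul_self (hgd z hz), hgradg, Real.rpow_neg_one, hadd, smul_smul,
      Tao2016.cross_smul_left, Tao2016.cross_self_eq_zero, smul_zero, zero_add, Tao2016.cross_smul_left,
      cross_swap (gradient f z) z]
    simp only [hHdef, hsub, smul_sub, Tao2016.cross_smul_right, smul_smul, smul_neg]
    rw [show (‖z‖ ^ 2)⁻¹ = ‖z‖⁻¹ * ‖z‖⁻¹ by rw [sq, mul_inv]]
    abel
  /- (3) the test field is tangential; radial Euler balance: `⟪U, H⟫ = 0`, hence `⟪W, H⟫ = 0` -/
  have hHtan : ∀ z : E3, z ≠ 0 → inner ℝ (H z) z = 0 := by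
    intro z hz
    simp only [hHdef, inner_sub_left, real_inner_smul_left, hWtan z, hEulerf z hz, mul_zero, sub_zero]
  have hUH : ∀ z : E3, z ≠ 0 → inner ℝ (U z) (H z) = 0 := by
    intro z hz
    have hnz : ‖z‖ ≠ 0 := norm_ne_zero_iff.mpr hz
    have hDUU : fderiv ℝ U z (U z) = -gradient P z := eq_neg_of_add_eq_zero_left (hEuler z hz)
    -- `⟪U × y, curl U⟫ = ⟪y, DU[U]⟫ − ⟪U, DU[y]⟫ = −⟪y, ∇P⟫ = 0`
    have h1 : inner ℝ (cross (U z) z) (curl U z) = 0 := by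
      rw [inner_cross_curl, hEulerU z hz, inner_zero_right, sub_zero, hDUU, inner_neg_right, real_inner_comm,
        hEulerP z hz, neg_zero]
    -- `⟪U × y, y × H⟫ = ⟪U, y⟫⟪y, H⟫ − ⟪U, H⟫‖y‖²`
    rw [hω z hz, inner_smul_right, Tao2016.inner_cross_cross, real_inner_comm (H z) z, hHtan z hz, mul_zero,
      zero_sub, real_inner_self_eq_norm_sq, mul_neg, neg_eq_zero, mul_eq_zero, mul_eq_zero] at h1
    rcases h1 with h1 | h1 | h1
    · exact absurd h1 (inv_ne_zero hnz)
    · exact h1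
    · exact absurd h1 (pow_ne_zero 2 hnz)
  have hWH : ∀ z : E3, z ≠ 0 → inner ℝ (W z) (H z) = 0 := by
    intro z hz
    show inner ℝ (U z - (f z * ‖z‖⁻¹) • z) (H z) = 0
    rw [inner_sub_left, real_inner_smul_left, hUH z hz, real_inner_comm (H z) z, hHtan z hz, mul_zero, sub_zero]
  /- (4) tangential Euler balance: `∇B = −f H` off the origin -/
  have hgradB : ∀ z : E3, z ≠ 0 → gradient B z = -(f z • H z) := by
    intro z hz
    have hnz : ‖z‖ ≠ 0 := norm_ne_zero_iff.mpr hz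
    have hDUU : fderiv ℝ U z (U z) = -gradient P z := eq_neg_of_add_eq_zero_left (hEuler z hz)
    have hL : (1 / 2 : ℝ) • ((2 : ℕ) • ((innerSL ℝ) (U z)).comp (fderiv ℝ U z))
        = ((innerSL ℝ) (U z)).comp (fderiv ℝ U z) := by
      rw [two_nsmul, ← two_smul ℝ, smul_smul]
      norm_num
    have hBder : HasFDerivAt B (fderiv ℝ P z + ((innerSL ℝ) (U z)).comp (fderiv ℝ U z)) z := by
      have h := (hPd z hz).hasFDerivAt.add (((hUd z hz).hasFDerivAt.norm_sq).const_mul (1 / 2 : ℝ))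
      rw [hL] at h
      exact h
    apply ext_inner_right ℝ
    intro e
    rw [Literature.Analysis.FluidPDE.inner_gradient_left, hBder.fderiv, add_apply,
      ContinuousLinearMap.comp_apply, innerSL_apply_apply]
    -- `⟪U, DU[e]⟫ = ⟪e, DU[U]⟫ − ⟪U × e, curl U⟫`
    have h2 : inner ℝ (U z) (fderiv ℝ U z e)
        = inner ℝ e (fderiv ℝ U z (U z)) - inner ℝ (cross (U z) e) (curl U z) := by
      rw [inner_cross_curl]; ring
    have hUz : inner ℝ (U z) z * ‖z‖⁻¹ = f z := by simp only [hfdef, div_eq_mul_inv]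
    rw [← Literature.Analysis.FluidPDE.inner_gradient_left, h2, hDUU, inner_neg_right, hω z hz, inner_smul_right,
      Tao2016.inner_cross_cross, hUH z hz, zero_mul, sub_zero, real_inner_comm (H z) e, inner_neg_left,
      real_inner_smul_left, ← hUz, real_inner_comm (gradient P z) e]
    ring
  /- (5) the test field is irrotational off the origin -/
  have hcurlH : ∀ z : E3, z ≠ 0 → curl H z = 0 := by
    intro z hz
    have hnz : ‖z‖ ≠ 0 := norm_ne_zero_iff.mpr hz
    have hsub : curl H z = curl (fun w : E3 => ‖w‖⁻¹ • W w) z - curl (gradient f) z :=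
      curl_sub ((hninvd z hz).smul (hWd z hz)) (hgradfd z hz)
    rw [hsub, PoloidalField.curl_gradient_eq_zero_of_contDiffAt (hf2 z hz), sub_zero,
      curl_smul (hninvd z hz) (hWd z hz), hcurlW z hz, fderiv_eq_innerSL_gradient, curlCLM_smulRight_innerSL,
      gradient_norm_inv hz, Real.rpow_neg_one, Tao2016.cross_smul_left, smul_smul, ← add_smul]
    rw [show ‖z‖⁻¹ * (‖z‖ ^ 2)⁻¹ + -(‖z‖⁻¹ * (‖z‖ ^ 2)⁻¹) = 0 by ring, zero_smul]
  /- (6) hence `∇f × H = 0` off the origin (`curl (f H) = −curl ∇B = 0`) -/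
  have hcross : ∀ z : E3, z ≠ 0 → cross (gradient f z) (H z) = 0 := by
    intro z hz
    have hev : (fun w => f w • H w) =ᶠ[𝓝 z] fun w => -gradient B w := by
      filter_upwards [hopen.mem_nhds hz] with w hw
      rw [hgradB w hw, neg_neg]
    have h1 : curl (fun w => f w • H w) z = 0 := by
      rw [curl_eq_curlCLM, hev.fderiv_eq, ← curl_eq_curlCLM, curl_neg,
        PoloidalField.curl_gradient_eq_zero_of_contDiffAt (hB2 z hz), neg_zero]
    rw [curl_smul (hfd z hz) (hHd z hz), hcurlH z hz, smul_zero, zero_add, fderiv_eq_innerSL_gradient,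
      curlCLM_smulRight_innerSL] at h1
    exact h1
  /- (7) pointwise dichotomy: where `H ≠ 0` the tangential part vanishes -/
  have hdich : ∀ z : E3, z ≠ 0 → H z ≠ 0 → W z = 0 := by
    intro z hz hH
    have hnz : ‖z‖ ≠ 0 := norm_ne_zero_iff.mpr hz
    obtain ⟨μ, hμ⟩ := exists_eq_smul_of_cross_eq_zero hH (hcross z hz)
    have hWz : W z = (‖z‖ * (1 + μ)) • H z := by
      have : ‖z‖ • H z = W z - ‖z‖ • gradient f z := by
        simp only [hHdef, smul_sub, smul_smul, mul_inv_cancel₀ hnz, one_smul]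
      rw [mul_smul, add_smul, one_smul, ← hμ, smul_add, this, sub_add_cancel]
    have h0 := hWH z hz
    rw [hWz, real_inner_smul_left, real_inner_self_eq_norm_sq, mul_eq_zero, mul_eq_zero] at h0
    rcases h0 with (h0 | h0) | h0
    · exact absurd h0 hnz
    · rw [hWz, h0, mul_zero, zero_smul]
    · exact absurd (pow_eq_zero_iff two_ne_zero |>.mp h0) (norm_ne_zero_iff.mpr hH)
  /- (8) the test field vanishes identically off the origin -/
  have hnear : ∀ z : E3, z ≠ 0 → H z ≠ 0 → ∀ᶠ w in 𝓝 z, w ≠ 0 ∧ H w ≠ 0 := by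
    intro z hz hH
    have hHc : ContinuousAt H z := (hHd z hz).continuousAt
    have h1 : ∀ᶠ w in 𝓝 z, w ≠ 0 := eventually_ne_nhds hz
    exact h1.and (hHc.eventually_ne hH)
  have hg0 : ∀ z : E3, z ≠ 0 → H z ≠ 0 → f z * ‖z‖⁻¹ = 0 := by
    intro z hz hH
    have hW0 : W =ᶠ[𝓝 z] fun _ => (0 : E3) := (hnear z hz hH).mono fun w hw => hdich w hw.1 hw.2
    have hdivW0 : VectorCalculus.divergence W z = 0 := by
      unfold VectorCalculus.divergence
      rw [hW0.fderiv_eq, fderiv_fun_const, Pi.zero_apply, ContinuousLinearMap.toLinearMap_zero, map_zero]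
    have hd1 : DifferentiableAt ℝ (fun w : E3 => (f w * ‖w‖⁻¹) • w) z := (hgd z hz).smul differentiableAt_id
    have hdivW : VectorCalculus.divergence W z = -(2 * (f z * ‖z‖⁻¹)) := by
      have hsplit : VectorCalculus.divergence W z
          = VectorCalculus.divergence U z - VectorCalculus.divergence (fun w : E3 => (f w * ‖w‖⁻¹) • w) z := by
        simp only [VectorCalculus.divergence, hWdef]
        rw [fderiv_fun_sub (hUd z hz) hd1, ContinuousLinearMap.toLinearMap_sub, map_sub]
      rw [hsplit, hdiv z hz, HorizonTower.divergence_smul_apply (u := fun w : E3 => w) (hgd z hz) differentiableAt_id,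
        hEulerg z hz, Sverak2011.divergence_id_three]
      ring
    linarith
  have hH0 : ∀ z : E3, z ≠ 0 → H z = 0 := by
    intro z hz
    by_contra hH
    have hf0 : f =ᶠ[𝓝 z] fun _ => (0 : ℝ) := (hnear z hz hH).mono fun w hw => by
      have h := hg0 w hw.1 hw.2
      have hnw : ‖w‖⁻¹ ≠ 0 := inv_ne_zero (norm_ne_zero_iff.mpr hw.1)
      exact (mul_eq_zero.mp h).resolve_right hnw
    have hgrad0 : gradient f z = 0 := by
      rw [gradient, hf0.fderiv_eq, fderiv_fun_const, Pi.zero_apply, map_zero]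
    have hWz : W z = 0 := hdich z hz hH
    apply hH
    simp only [hHdef, hWz, smul_zero, hgrad0, sub_zero]
  /- (9) so the profile is irrotational, hence constant -/
  have hcurl0 : ∀ z : E3, z ≠ 0 → curl U z = 0 := by
    intro z hz
    rw [hω z hz, hH0 z hz, cross_zero_right, smul_zero]
  set x₁ : E3 := EuclideanSpace.single (0 : Fin 3) (1 : ℝ) with hx₁
  have hx₁0 : x₁ ≠ 0 := by
    intro h
    have := congrArg (fun v : E3 => v 0) h
    simp [hx₁] at this
  refine ⟨U x₁, fun x hx => ?_⟩
  exact eq_of_curl_eq_zero hU hUhom hdiv hcurl0 hx₁0 hx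

/-- **(J) CONICAL STEADY EULER RIGIDITY** (body of the sketch's `ConicalSteadyEulerRigidity`, `PrecessionSketch.lean`
l.235, VERBATIM): a real-analytic degree-0 homogeneous steady Euler field on `ℝ³ ∖ {0}` with real-analytic degree-0
homogeneous pressure, divergence free, with vorticity tangent to the spheres about `0`, is CONSTANT — the `C²` theorem
`conicalSteadyEulerRigidity_of_contDiffOn` applied to the analytic (hence `C²`) data.
[cite: MajdaBertozziCUP2002, §1.1 (vector identities), §2.4.1; GilbargTrudinger2001, Thm 3.5] -/
theorem conicalSteadyEulerRigidity :
    ∀ (U : E3 → E3) (P : E3 → ℝ), AnalyticOnNhd ℝ U {0}ᶜ → AnalyticOnNhd ℝ P {0}ᶜ →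
    (∀ c : ℝ, 0 < c → ∀ x, U (c • x) = U x) → (∀ c : ℝ, 0 < c → ∀ x, x ≠ 0 → P (c • x) = P x) →
    (∀ x, x ≠ 0 → VectorCalculus.divergence U x = 0) →
    (∀ x, x ≠ 0 → fderiv ℝ U x (U x) + gradient P x = 0) →
    (∀ x, x ≠ 0 → inner ℝ x (curl U x) = 0) →
    ∃ a : E3, ∀ x, x ≠ 0 → U x = a :=
  fun U P hUan hPan hUhom hPhom hdiv hEuler hrot =>
    conicalSteadyEulerRigidity_of_contDiffOn U P hUan.contDiffOn_of_completeSpace hPan.contDiffOn_of_completeSpace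
      hUhom hPhom hdiv hEuler hrot


end Summit.NavierStokesRegularity.NavierStokesRegularity.Theorems.PoloidalLiouville.Precession

end
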